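import Literature.Probability.LatticeModels.PlanarIsingOnsagerLengthBound
import Literature.Probability.LatticeModels.LayeredPlaneRotatorFisherWindow
import Literature.Probability.LatticeModels.LayeredPlaneRotatorLogSquaredLaw
import Literature.Probability.LatticeModels.PlaneRotatorOnsagerWindow
import HarnessLib

/-!
# The closed-form Aizenman–Simon–Onsager window of the layered plane rotator:
# across-layer decay and finite stack susceptibility whenever `βJ⊥ · X(βJ∥/2) < 1`,
# `X(β') = 1 + 8q/(1−q)²`, `q = e^{2β'} tanh β'`, for every `βJ∥ < log(1+√2)`

Topic `Literature/Probability/LatticeModels`, namespace `Literature.Probability.LatticeModels` (rotator-side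
declarations under `PlaneRotator`). Companion of `PlanarIsingOnsagerLengthBound.lean` (p2 g24: the planar Ising
two-point function below Onsager's correlation length with constant one,
`⟨σ₀σ_x⟩^∅_{β'} ≤ q(β')^{‖x‖_∞}`, `q = γ₂(β')⁻¹ = e^{2β'} tanh β' < 1 ⇔ β' < β_c(2)`).

Summing that bound over `ℤ²` with the exact shell sums of `LayeredPlaneRotatorLogSquaredLaw.lean`
(`∑_{z} q^{‖z‖_∞} ≤ 1 + 8q/(1−q)²`) gives a CLOSED-FORM ceiling on every finite-volume planar Ising susceptibility,
`∑_{v ∈ Λ} ⟨σ_uσ_v⟩^∅_{Λ;β'} ≤ X(β') := 1 + 8q/(1−q)²` (§1), valid up to the critical point. Aizenman–Simon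
(`⟨cos(θ_a − θ_x)⟩_{2β'} ≤ ⟨σ_aσ_x⟩_{β'}`, tree `sum_twoPoint_inPlane_le_of_isingBound`) turns it into a single-layer
susceptibility ceiling of the classical layered XY comparison model at `β' = βJ∥/2`, and Lieb–Rivasseau (tree
`twoPoint_layered_le_pow_interlayer'`, `sum_twoPoint_layered_le_of_interlayer`) into (§2):

* across-layer decay `⟨cos(θ_a − θ_c)⟩_{Λ;β,J∥,J⊥} ≤ (βJ⊥ X(βJ∥/2))^{|ℓ(a) − ℓ(c)|}` at every finite `Λ ⊂ ℤ³`;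
* row sums `≤ X/(1 − βJ⊥X)` uniformly in `Λ`, hence `∑_z G^{3D,free,∞}(x,z) ≤ X/(1 − βJ⊥X)` and
  **`ofReal K ≤ K_χ^{3D}(Δ)` whenever `Δ·K·X(K/2) < 1`** (`layeredSusceptibilityCriticalCoupling`), also `≤ K_Υ^{3D}(Δ,i)`;
* §3: the same for the single layer in infinite volume — `G^{2D,free,∞}_K(0,z) ≤ q(K/2)^{‖z‖_∞}`,
  `χ₂^{free}(K) ≤ X(K/2)`, and the closed-form MASS-GAP FLOOR `ofReal(log γ₂(K/2)) ≤ massGap K 2`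
  (`1/ξ₂(K) ≥ log coth(K/2) − K`) for every `0 < K < log(1+√2)`;
* §4: rational-enclosure forms (`e^{K} ≤ E` ⇒ `q ≤ E(E−1)/(E+1)`; `X` monotone in `q`) for decimal consumers.

Numbers (NOT asserted in Lean; `work/window.py` of the cell seat): the window `Δ·K·X(K/2) < 1` reaches
`K₀(Δ) = 0.5544 (Δ = 1/8), 0.6885 (1/32), 0.7631 (1/100), 0.7950 (1/200), 0.8364 (1/800), 0.8608 (1/4000),
0.8683 (10⁻⁴)`, increasing to the Aizenman–Simon–Onsager point `log(1+√2) = 0.8814` as `Δ → 0`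
(`LayeredPlaneRotatorOnsagerWindow.lean`, qualitative there). Beyond `Δ ≈ 1/40` the certificate-free Fisher window
(`LayeredPlaneRotatorFisherWindow.lean`, `2/π ∀ Δ ≤ 1/8`, `log 2 ∀ Δ ≤ 1/32`) is sharper; below it this window is, and it
needs no self-avoiding-walk census and no Toeplitz number (`LayeredPlaneRotatorToeplitzCertificate.lean`: `K = 0.86` at
`Δ ≤ 1/800` with two kit-certified numbers; here `0.8364` in closed form).

Cell use (`pub/hubbard-tc`, MO-S3 ORDER → T_c back-end, seat p2 «2D → 3D ordering lemmas»; lead g9 RULING R118):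
beside-class (K5 dictionary) input; the Observables socket `XYDictionaryAt.le_div_of_ofReal_le_layeredSusceptibilityCriticalCoupling`
(p605488) turns §2/§4 into `T_c ≤ C/(2K₀(Δ))` rows.

## What this is not

No statement about any quantum/Hubbard model; no lower bound on any ordering temperature; no value of
`K_χ^{3D}(Δ)` (only lower bounds); nothing at `Δ ≥ 1/32` beyond what the Fisher window already gives; the sup-norm
rate `log γ₂` ignores the Ornstein–Zernike prefactor (≈ ×5 in `χ` against the exact Toeplitz row data near `β_c`).
-/

noncomputable section

open Finset Filter
open scoped BigOperators Topology ENNReal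

namespace Literature.Probability.LatticeModels

/-! ## §1 The planar Ising susceptibility in closed form up to `β_c(2)` -/

section IsingSusceptibility

/-- **Closed-form finite-volume planar Ising susceptibility ceiling up to the critical point**: for
`0 < β < β_c(2) = ½log(1+√2)`, every finite `Λ ⊂ ℤ²` (free boundary condition) and `u ∈ Λ`,

  `∑_{v ∈ Λ} ⟨σ_uσ_v⟩^∅_{Λ;β} ≤ 1 + 8q/(1−q)²`,  `q = γ₂(β)⁻¹ = e^{2β} tanh β`

(volume monotonicity and translation covariance `⟨σ_uσ_v⟩_Λ ≤ ⟨σ₀σ_{v−u}⟩^∅`, the constant-one Onsager-length bound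
`twoPointFree_two_le_inv_onsagerGammaTwo_pow_supNorm`, and the exact `ℤ²` shell sums `sum_pow_supNorm_two_le`).
[cite: Wu1966, T > T_c asymptotics of D_n(φ_Onsager) (= DeiftItsKrasovsky2013 §5 eq. (64))]
[cite: Simon1980CMP, Thm 1.3 (exponential decay summed over the lattice)] -/
theorem sum_isingTwoPoint_two_free_le_onsagerLength {β : ℝ} (hβ0 : 0 < β) (hβc : β < criticalBetaTwo)
    (Λ : Finset (Site 2)) {u : Site 2} (hu : u ∈ Λ) :
    ∑ v ∈ Λ, isingTwoPoint (zdGraph 2) Λ β 0 .free u v ≤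
      1 + 8 * ((onsagerGammaTwo β)⁻¹ / (1 - (onsagerGammaTwo β)⁻¹) ^ 2) := by
  classical
  have hq0 : 0 ≤ (onsagerGammaTwo β)⁻¹ := (inv_onsagerGammaTwo_pos hβ0).le
  have hq1 : (onsagerGammaTwo β)⁻¹ < 1 := (inv_onsagerGammaTwo_lt_one_iff hβ0).2 hβc
  calc ∑ v ∈ Λ, isingTwoPoint (zdGraph 2) Λ β 0 .free u v
      ≤ ∑ v ∈ Λ, twoPointFree 2 β (v - u) :=
        Finset.sum_le_sum fun v hv => isingTwoPoint_box_le_twoPointFree hβ0.le hu hv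
    _ = ∑ w ∈ Λ.image (· - u), twoPointFree 2 β w := by
        rw [Finset.sum_image fun x _ y _ h => sub_left_injective h]
    _ ≤ ∑ w ∈ Λ.image (· - u), (onsagerGammaTwo β)⁻¹ ^ Site.supNorm w :=
        Finset.sum_le_sum fun w _ => twoPointFree_two_le_inv_onsagerGammaTwo_pow_supNorm hβ0 hβc w
    _ ≤ 1 + 8 * ((onsagerGammaTwo β)⁻¹ / (1 - (onsagerGammaTwo β)⁻¹) ^ 2) := PlaneRotator.sum_pow_supNorm_two_le hq0 hq1 _

/-- **Monotonicity of the closed form in `q`**: `q ↦ 1 + 8q/(1−q)²` is nondecreasing on `[0,1)`.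
[cite: Simon1980CMP, Thm 1.3 — bookkeeping] -/
theorem onsagerLength_closedForm_mono {q q' : ℝ} (hq0 : 0 ≤ q) (hqq' : q ≤ q') (hq'1 : q' < 1) :
    1 + 8 * (q / (1 - q) ^ 2) ≤ 1 + 8 * (q' / (1 - q') ^ 2) := by
  have h1 : 0 < 1 - q' := sub_pos.2 hq'1
  have h2 : (1 - q') ^ 2 ≤ (1 - q) ^ 2 := pow_le_pow_left₀ h1.le (by linarith) 2
  have h3 : q / (1 - q) ^ 2 ≤ q' / (1 - q') ^ 2 := div_le_div₀ (hq0.trans hqq') hqq' (pow_pos h1 2) h2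
  linarith

/-- **Monotone consumption form with an enclosure of `q`**: for `β > 0` and any `q̄` with `γ₂(β)⁻¹ ≤ q̄ < 1`,
`∑_{v ∈ Λ} ⟨σ_uσ_v⟩^∅_{Λ;β} ≤ 1 + 8q̄/(1−q̄)²` (the window `β < β_c(2)` follows from `q̄ < 1`). [cite: Wu1966, T > T_c asymptotics of D_n(φ_Onsager) (= DeiftItsKrasovsky2013 §5 eq. (64))] -/
theorem sum_isingTwoPoint_two_free_le_of_inv_onsagerGammaTwo_le {β q : ℝ} (hβ0 : 0 < β)
    (hq : (onsagerGammaTwo β)⁻¹ ≤ q) (hq1 : q < 1) (Λ : Finset (Site 2)) {u : Site 2} (hu : u ∈ Λ) :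
    ∑ v ∈ Λ, isingTwoPoint (zdGraph 2) Λ β 0 .free u v ≤ 1 + 8 * (q / (1 - q) ^ 2) := by
  have hβc : β < criticalBetaTwo := (inv_onsagerGammaTwo_lt_one_iff hβ0).1 (hq.trans_lt hq1)
  exact (sum_isingTwoPoint_two_free_le_onsagerLength hβ0 hβc Λ hu).trans
    (onsagerLength_closedForm_mono (inv_onsagerGammaTwo_pos hβ0).le hq hq1)

end IsingSusceptibility

namespace PlaneRotator

/-! ## §2 The layered comparison model: across-layer decay, row sums, `K_χ^{3D}(Δ)` -/

section Layered

open Literature.Barriers.CriticalPhenomena Literature.Barriers.CriticalPhenomena.LongRangeIsing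

variable {β Jp Jz : ℝ}
variable [MeasurableSpace Circle] [BorelSpace Circle]

/-- **Single-layer susceptibility of the layered XY model in closed form** (Aizenman–Simon on the layer, then §1 at
`β' = βJ∥/2 < β_c(2)`): for every finite `Λ ⊂ ℤ³` and `a ∈ Λ`,
`∑_{x ∈ Λ_{ℓ(a)}} ⟨cos(θ_a − θ_x)⟩^{2D}_{Λ_{ℓ(a)}} ≤ 1 + 8q/(1−q)²`, `q = γ₂(βJ∥/2)⁻¹`.
[cite: AizenmanSimon1980RotorIsing, eq. (1)] [cite: Wu1966, T > T_c asymptotics of D_n(φ_Onsager) (= DeiftItsKrasovsky2013 §5 eq. (64))] -/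
theorem sum_twoPoint_inPlane_le_onsagerLength (hβ : 0 < β) (hp : 0 < Jp) (hz : 0 ≤ Jz)
    (hc : β * Jp / 2 < criticalBetaTwo) (Λ : Finset (Site 3)) (a : Λ) :
    ∑ x ∈ univ.filter (fun x : Λ => layer x = layer a),
        twoPoint (inPlane (layeredXYCoupling β Jp Jz Λ) (layer a)) a x ≤
      1 + 8 * ((onsagerGammaTwo (β * Jp / 2))⁻¹ / (1 - (onsagerGammaTwo (β * Jp / 2))⁻¹) ^ 2) :=
  sum_twoPoint_inPlane_le_of_isingBound hβ.le hp.le hz Λ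
    (fun S _ hu => sum_isingTwoPoint_two_free_le_onsagerLength (by positivity) hc S hu) a

/-- **Across-layer decay of the layered XY model in the closed-form window** (Lieb–Rivasseau decoupling
`twoPoint_layered_le_pow_interlayer'` with the closed-form layer susceptibility): for `β, J∥ > 0`, `J⊥ ≥ 0`,
`βJ∥/2 < β_c(2)`, every finite `Λ ⊂ ℤ³` and all `a, c ∈ Λ`,

  `⟨cos(θ_a − θ_c)⟩_{Λ;β,J∥,J⊥} ≤ (βJ⊥ · X)^{|ℓ(a) − ℓ(c)|}`,  `X = 1 + 8q/(1−q)²`, `q = e^{βJ∥} tanh(βJ∥/2)`.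

Whenever `βJ⊥X < 1` this is geometric decay ACROSS the layers uniformly in the volume (no three-dimensional order
at `k_BT = 1/β`) — the body of the cell's K5 trigger `LayeredXYDecayAt β J∥ J⊥`, with no certificate input.
[cite: Lieb1980, eq. (23) and notes added in proof (2)] [cite: AizenmanSimon1980RotorIsing, eq. (1)]
[cite: Wu1966, T > T_c asymptotics of D_n(φ_Onsager) (= DeiftItsKrasovsky2013 §5 eq. (64))] -/
theorem twoPoint_layered_le_pow_onsagerLength (hβ : 0 < β) (hp : 0 < Jp) (hz : 0 ≤ Jz)
    (hc : β * Jp / 2 < criticalBetaTwo) (Λ : Finset (Site 3)) (a c : Λ) :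
    twoPoint (layeredXYCoupling β Jp Jz Λ) a c ≤
      (β * Jz * (1 + 8 * ((onsagerGammaTwo (β * Jp / 2))⁻¹ /
        (1 - (onsagerGammaTwo (β * Jp / 2))⁻¹) ^ 2))) ^ (layer a - layer c).natAbs :=
  twoPoint_layered_le_pow_interlayer' hβ.le hp.le hz Λ
    (fun a' => sum_twoPoint_inPlane_le_onsagerLength hβ hp hz hc Λ a') a c

/-- **Monotone consumption form** (enclosures `γ₂(βJ∥/2)⁻¹ ≤ q̄ < 1`, `βJ⊥(1 + 8q̄/(1−q̄)²) ≤ r`):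
`⟨cos(θ_a − θ_c)⟩_{Λ;β,J∥,J⊥} ≤ r^{|ℓ(a) − ℓ(c)|}` — the shape consumed by the K5 dictionary.
[cite: Lieb1980, eq. (23) and notes added in proof (2)] [cite: AizenmanSimon1980RotorIsing, eq. (1)] -/
theorem twoPoint_layered_le_pow_of_inv_onsagerGammaTwo_le (hβ : 0 < β) (hp : 0 < Jp) (hz : 0 ≤ Jz)
    {q r : ℝ} (hq : (onsagerGammaTwo (β * Jp / 2))⁻¹ ≤ q) (hq1 : q < 1)
    (hr : β * Jz * (1 + 8 * (q / (1 - q) ^ 2)) ≤ r) (Λ : Finset (Site 3)) (a c : Λ) :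
    twoPoint (layeredXYCoupling β Jp Jz Λ) a c ≤ r ^ (layer a - layer c).natAbs := by
  have hβ' : 0 < β * Jp / 2 := by positivity
  have hX : ∀ a' : Λ, ∑ x ∈ univ.filter (fun x : Λ => layer x = layer a'),
      twoPoint (inPlane (layeredXYCoupling β Jp Jz Λ) (layer a')) a' x ≤ 1 + 8 * (q / (1 - q) ^ 2) :=
    fun a' => sum_twoPoint_inPlane_le_of_isingBound hβ.le hp.le hz Λ
      (fun S _ hu => sum_isingTwoPoint_two_free_le_of_inv_onsagerGammaTwo_le hβ' hq hq1 S hu) a'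
  have hq0 : 0 ≤ q := (inv_onsagerGammaTwo_pos hβ').le.trans hq
  have h0 : 0 ≤ β * Jz * (1 + 8 * (q / (1 - q) ^ 2)) := by positivity
  exact (twoPoint_layered_le_pow_interlayer' hβ.le hp.le hz Λ hX a c).trans (pow_le_pow_left₀ h0 hr _)

/-- **The RPA stack susceptibility in the closed-form window** (uniformly in the volume): `β, J∥ > 0`, `J⊥ ≥ 0`,
`βJ∥/2 < β_c(2)`, `βJ⊥X < 1` ⇒ every row sum `∑_{c ∈ Λ} ⟨cos(θ_a − θ_c)⟩_{Λ;β,J∥,J⊥} ≤ X/(1 − βJ⊥X)`.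
[cite: Lieb1980, eq. (23) and notes added in proof (2); Simon1980CMP, Thm 1.3; LiuStanley1972, p. 272]
[cite: Wu1966, T > T_c asymptotics of D_n(φ_Onsager) (= DeiftItsKrasovsky2013 §5 eq. (64))] -/
theorem sum_twoPoint_layered_le_of_onsagerLength (hβ : 0 < β) (hp : 0 < Jp) (hz : 0 ≤ Jz)
    (hc : β * Jp / 2 < criticalBetaTwo)
    (hA : β * Jz * (1 + 8 * ((onsagerGammaTwo (β * Jp / 2))⁻¹ /
      (1 - (onsagerGammaTwo (β * Jp / 2))⁻¹) ^ 2)) < 1) (Λ : Finset (Site 3)) (a : Λ) :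
    ∑ c, twoPoint (layeredXYCoupling β Jp Jz Λ) a c ≤
      (1 + 8 * ((onsagerGammaTwo (β * Jp / 2))⁻¹ / (1 - (onsagerGammaTwo (β * Jp / 2))⁻¹) ^ 2)) /
        (1 - β * Jz * (1 + 8 * ((onsagerGammaTwo (β * Jp / 2))⁻¹ /
          (1 - (onsagerGammaTwo (β * Jp / 2))⁻¹) ^ 2))) :=
  sum_twoPoint_layered_le_of_interlayer hβ.le hp.le hz Λ
    (fun a' => sum_twoPoint_inPlane_le_onsagerLength hβ hp hz hc Λ a') hA a

/-- **Infinite volume**: under the same hypotheses `∑_z G^{3D,free,∞}_{β;J∥,J⊥}(x, z)` converges and is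
`≤ X/(1 − βJ⊥X)` — the stack susceptibility is finite throughout the closed-form window.
[cite: Simon1980CMP, Thm 1.3; Lieb1980, eq. (23)] [cite: Wu1966, T > T_c asymptotics of D_n(φ_Onsager) (= DeiftItsKrasovsky2013 §5 eq. (64))] -/
theorem tsum_infTwoPointLayered_le_of_onsagerLength (hβ : 0 < β) (hp : 0 < Jp) (hz : 0 ≤ Jz)
    (hc : β * Jp / 2 < criticalBetaTwo)
    (hA : β * Jz * (1 + 8 * ((onsagerGammaTwo (β * Jp / 2))⁻¹ /
      (1 - (onsagerGammaTwo (β * Jp / 2))⁻¹) ^ 2)) < 1) (x : Site 3) :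
    (Summable fun z : Site 3 => infTwoPointLayered β Jp Jz x z) ∧
      ∑' z : Site 3, infTwoPointLayered β Jp Jz x z ≤
        (1 + 8 * ((onsagerGammaTwo (β * Jp / 2))⁻¹ / (1 - (onsagerGammaTwo (β * Jp / 2))⁻¹) ^ 2)) /
          (1 - β * Jz * (1 + 8 * ((onsagerGammaTwo (β * Jp / 2))⁻¹ /
            (1 - (onsagerGammaTwo (β * Jp / 2))⁻¹) ^ 2))) :=
  ⟨summable_infTwoPointLayered_of_forall_box hβ.le hp.le hz
      (fun n a => sum_twoPoint_layered_le_of_onsagerLength hβ hp hz hc hA (box 3 n) a) x,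
    tsum_infTwoPointLayered_le_of_forall_box hβ.le hp.le hz
      (fun n a => sum_twoPoint_layered_le_of_onsagerLength hβ hp hz hc hA (box 3 n) a) x⟩

/-- **THE CLOSED-FORM WINDOW ON `K_χ^{3D}(Δ)`**: for `0 ≤ Δ`, `0 < K`, `K/2 < β_c(2)` and
`Δ·K·X(K/2) < 1`, `X(K/2) = 1 + 8q/(1−q)²`, `q = γ₂(K/2)⁻¹ = e^{K} tanh(K/2)`:

  `ENNReal.ofReal K ≤ layeredSusceptibilityCriticalCoupling Δ`,

i.e. the layered comparison model with couplings `(J∥, ΔJ∥)` has finite stack susceptibility at every `βJ∥ ≤ K` —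
`T_χ^{3D}(J∥, ΔJ∥) ≤ J∥/K`, hence every ordering temperature of the stack `≤ J∥/K`. The window `K₀(Δ)` solving
`Δ·K₀·X(K₀/2) = 1` increases to the Aizenman–Simon–Onsager point `log(1+√2)` as `Δ → 0`.
[cite: LiuStanley1972, p. 272 (interlayer mean-field T_c(ε))] [cite: AizenmanSimon1980RotorIsing, eq. (2)]
[cite: Wu1966, T > T_c asymptotics of D_n(φ_Onsager) (= DeiftItsKrasovsky2013 §5 eq. (64))] -/
theorem ofReal_le_layeredSusceptibilityCriticalCoupling_of_onsagerLength {Δ K : ℝ} (hΔ : 0 ≤ Δ) (hK : 0 < K)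
    (hKc : K / 2 < criticalBetaTwo)
    (h : Δ * K * (1 + 8 * ((onsagerGammaTwo (K / 2))⁻¹ / (1 - (onsagerGammaTwo (K / 2))⁻¹) ^ 2)) < 1) :
    ENNReal.ofReal K ≤ layeredSusceptibilityCriticalCoupling Δ := by
  have hc : 1 * K / 2 < criticalBetaTwo := by rwa [one_mul]
  have hA : 1 * (Δ * K) * (1 + 8 * ((onsagerGammaTwo (1 * K / 2))⁻¹ /
      (1 - (onsagerGammaTwo (1 * K / 2))⁻¹) ^ 2)) < 1 := by rwa [one_mul, one_mul]
  exact ofReal_le_layeredSusceptibilityCriticalCoupling hK.le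
    (tsum_infTwoPointLayered_le_of_onsagerLength one_pos hK (mul_nonneg hΔ hK.le) hc hA 0).1

end Layered

/-! ## §3 One layer in infinite volume: `G^{2D}_K ≤ q(K/2)^{‖z‖_∞}`, `χ₂(K) ≤ X(K/2)`, the mass-gap floor -/

section TwoDim

open Literature.Barriers.CriticalPhenomena Literature.Barriers.CriticalPhenomena.LongRangeIsing

variable {ν : ℕ}
variable [MeasurableSpace Circle] [BorelSpace Circle]

omit [MeasurableSpace Circle] [BorelSpace Circle] in
/-- Nearest neighbours of `ℤ^ν`: `nnCoupling ν x y = 𝟙{x ∼ y}` for `zdGraph ν` (local copy of the private lemma of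
`PlaneRotatorOnsagerWindow.lean`). [folklore] -/
private theorem nnCoupling_eq_indicator_adj (x y : Site ν) :
    nnCoupling ν x y = if (zdGraph ν).Adj x y then 1 else 0 := by
  have hadj : (zdGraph ν).Adj x y ↔ l1Norm (x - y) = 1 := by
    rw [zdGraph_adj_iff_norm_holds x y]
    have h : ((l1Norm (x - y) : ℕ) : ℤ) = ∑ i, |x i - y i| := by
      simp only [l1Norm, Nat.cast_sum, Int.natCast_natAbs, Pi.sub_apply]
    rw [← h]
    norm_cast
  unfold nnCoupling
  simp only [hadj]

/-- **Aizenman–Simon pointwise, against the free state of `ℤ^ν`**: for the nearest-neighbour XY model at coupling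
`K ≥ 0` on any finite `Λ ⊂ ℤ^ν` (free boundary conditions) and `a, c ∈ Λ`,
`⟨cos(θ_a − θ_c)⟩_{Λ,K} ≤ ⟨σ₀σ_{c−a}⟩^∅_{K/2}` (eq. (1) on `Λ`, then Griffiths in the volume).
[cite: AizenmanSimon1980RotorIsing, eq. (1)] [cite: FriedliVelenik2017, Exercise 3.12] -/
theorem twoPoint_nn_le_twoPointFree_half {K : ℝ} (hK : 0 ≤ K) (Λ : Finset (Site ν)) (a c : Λ) :
    twoPoint (nnXYCoupling K ν Λ) a c ≤ twoPointFree ν (K / 2) ((c : Site ν) - a) := by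
  classical
  set cpl : Λ → Λ → ℝ := fun x y => K / 4 * nnCoupling ν (x : Site ν) y with hcpl
  have hc0 : ∀ x y, 0 ≤ cpl x y := fun x y => mul_nonneg (by positivity) (nnCoupling_nonneg _ _)
  have h := AizenmanSimonRotorIsingComparison_holds Λ cpl hc0 a c
  have hJ : (fun p : Λ × Λ => 2 * cpl p.1 p.2) = nnXYCoupling K ν Λ := by
    funext p
    simp only [hcpl, nnXYCoupling]
    ring
  rw [hJ] at h
  refine h.trans (PairIsing.avg_spinPair_le_twoPointFree (by positivity : (0 : ℝ) ≤ K / 2) Λ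
    (fun x y => ?_) a c)
  simp only [hcpl]
  rw [nnCoupling_eq_indicator_adj]
  split_ifs
  · rw [mul_one, abs_of_nonneg (by positivity)]
    linarith
  · simp

/-- **The free infinite-volume XY two-point function of `ℤ^ν` below the Ising free state at half coupling**:
`G_K(0, z) ≤ ⟨σ₀σ_z⟩^∅_{K/2}` for `K ≥ 0` (box by box, `infTwoPoint_le_of_forall_box`).
[cite: AizenmanSimon1980RotorIsing, eq. (1)] -/
theorem infTwoPoint_le_twoPointFree_half {K : ℝ} (hK : 0 ≤ K) (z : Site ν) :
    infTwoPoint K ν 0 z ≤ twoPointFree ν (K / 2) z := by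
  refine infTwoPoint_le_of_forall_box fun n => ?_
  by_cases h : (0 : Site ν) ∈ box ν n ∧ z ∈ box ν n
  · rw [volTwoPoint_of_mem K h.1 h.2]
    simpa using twoPoint_nn_le_twoPointFree_half hK (box ν n) ⟨0, h.1⟩ ⟨z, h.2⟩
  · unfold volTwoPoint
    rw [dif_neg h]
    exact twoPointFree_nonneg' (by positivity) z

/-- **One layer in infinite volume, closed form**: for `0 < K` with `K/2 < β_c(2)` (i.e. `K < log(1+√2)`) and every
`z ∈ ℤ²`, `G^{2D,free,∞}_K(0, z) ≤ q^{‖z‖_∞}`, `q = γ₂(K/2)⁻¹ = e^{K} tanh(K/2)`.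
[cite: AizenmanSimon1980RotorIsing, eqs. (1)–(2)] [cite: Wu1966, T > T_c asymptotics of D_n(φ_Onsager) (= DeiftItsKrasovsky2013 §5 eq. (64))] -/
theorem infTwoPoint_two_le_inv_onsagerGammaTwo_pow {K : ℝ} (hK : 0 < K) (hKc : K / 2 < criticalBetaTwo)
    (z : Site 2) : infTwoPoint K 2 0 z ≤ (onsagerGammaTwo (K / 2))⁻¹ ^ Site.supNorm z :=
  (infTwoPoint_le_twoPointFree_half hK.le z).trans
    (twoPointFree_two_le_inv_onsagerGammaTwo_pow_supNorm (by positivity) hKc z)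

/-- **The single-layer susceptibility in closed form**: `0 < K`, `K/2 < β_c(2)` ⇒ `∑_z G^{2D,free,∞}_K(0,z)` converges
and is `≤ 1 + 8q/(1−q)²`, `q = γ₂(K/2)⁻¹`. [cite: Simon1980CMP, Thm 1.3] [cite: AizenmanSimon1980RotorIsing, eqs. (1)–(2)]
[cite: Wu1966, T > T_c asymptotics of D_n(φ_Onsager) (= DeiftItsKrasovsky2013 §5 eq. (64))] -/
theorem tsum_infTwoPoint_two_le_onsagerLength {K : ℝ} (hK : 0 < K) (hKc : K / 2 < criticalBetaTwo) :
    (Summable fun z : Site 2 => infTwoPoint K 2 0 z) ∧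
      ∑' z : Site 2, infTwoPoint K 2 0 z ≤
        1 + 8 * ((onsagerGammaTwo (K / 2))⁻¹ / (1 - (onsagerGammaTwo (K / 2))⁻¹) ^ 2) := by
  have hq0 : 0 ≤ (onsagerGammaTwo (K / 2))⁻¹ := (inv_onsagerGammaTwo_pos (by positivity)).le
  have hq1 : (onsagerGammaTwo (K / 2))⁻¹ < 1 := (inv_onsagerGammaTwo_lt_one_iff (by positivity)).2 hKc
  have hle : ∀ z : Site 2, infTwoPoint K 2 0 z ≤ (onsagerGammaTwo (K / 2))⁻¹ ^ Site.supNorm z :=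
    infTwoPoint_two_le_inv_onsagerGammaTwo_pow hK hKc
  have h0 : ∀ z : Site 2, 0 ≤ infTwoPoint K 2 0 z := infTwoPoint_nonneg hK.le 0
  have hsum : Summable fun z : Site 2 => infTwoPoint K 2 0 z :=
    (summable_pow_supNorm_two hq0 hq1).of_nonneg_of_le h0 hle
  exact ⟨hsum, (hsum.tsum_le_tsum hle (summable_pow_supNorm_two hq0 hq1)).trans
    (tsum_pow_supNorm_two_le hq0 hq1)⟩

/-- **The closed-form mass-gap floor of the two-dimensional XY model**: for `0 < K`, `K/2 < β_c(2)`,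
`ofReal(log γ₂(K/2)) ≤ massGap K 2`, i.e. the free infinite-volume correlation length obeys
`1/ξ₂(K) ≥ log coth(K/2) − K > 0` throughout the Aizenman–Simon–Onsager window (the rate with constant one).
[cite: AizenmanSimon1980RotorIsing, eq. (2)] [cite: Wu1966, T > T_c asymptotics of D_n(φ_Onsager) (= DeiftItsKrasovsky2013 §5 eq. (64))] -/
theorem ofReal_log_onsagerGammaTwo_le_massGap {K : ℝ} (hK : 0 < K) (hKc : K / 2 < criticalBetaTwo) :
    ENNReal.ofReal (Real.log (onsagerGammaTwo (K / 2))) ≤ massGap K 2 := by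
  refine ofReal_le_massGap ⟨log_onsagerGammaTwo_pos (by positivity) hKc, 1, fun z => ?_⟩
  rw [abs_of_nonneg (infTwoPoint_nonneg hK.le 0 z), one_mul]
  exact (infTwoPoint_le_twoPointFree_half hK.le z).trans
    (twoPointFree_two_le_exp_neg_log_onsagerGammaTwo_mul_norm (by positivity) hKc z)

end TwoDim

/-! ## §4 Rational-enclosure forms (one transcendental `E ≥ e^{K}` per evaluation point) -/

section Enclosure

open Literature.Barriers.CriticalPhenomena Literature.Barriers.CriticalPhenomena.LongRangeIsing

variable {β Jp Jz : ℝ}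
variable [MeasurableSpace Circle] [BorelSpace Circle]

omit [MeasurableSpace Circle] [BorelSpace Circle] in
/-- **Enclosing `q` by one exponential**: `0 ≤ K`, `e^{K} ≤ E` ⇒ `γ₂(K/2)⁻¹ ≤ E(E−1)/(E+1)`
(`γ₂(K/2)⁻¹ = a(a−1)/(a+1)` at `a = e^{K}`, increasing in `a ≥ 1`). [cite: DeiftItsKrasovsky2013, §2, eq. (22)] -/
theorem inv_onsagerGammaTwo_half_le_of_exp_le {K E : ℝ} (hK : 0 ≤ K) (hE : Real.exp K ≤ E) :
    (onsagerGammaTwo (K / 2))⁻¹ ≤ E * (E - 1) / (E + 1) := by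
  rw [inv_onsagerGammaTwo_eq_exp, show 2 * (K / 2) = K by ring]
  set a := Real.exp K with ha
  have ha1 : 1 ≤ a := by have h1 := Real.add_one_le_exp K; linarith
  have hba : 0 ≤ E - a := sub_nonneg.2 hE
  rw [div_le_div_iff₀ (by linarith) (by linarith)]
  nlinarith [mul_nonneg hba (show 0 ≤ a * E + a + E - 1 by
    nlinarith [mul_nonneg (sub_nonneg.2 ha1) (sub_nonneg.2 (ha1.trans hE))])]

/-- **THE CLOSED-FORM WINDOW, rational-enclosure form**: `0 ≤ Δ`, `0 < K`, `e^{K} ≤ E`,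
`q̄ := E(E−1)/(E+1) < 1` and `Δ·K·(1 + 8q̄/(1−q̄)²) < 1` ⇒ `ENNReal.ofReal K ≤ layeredSusceptibilityCriticalCoupling Δ`
(the hypothesis `K/2 < β_c(2)` is implied by `q̄ < 1`). With rational `K, E` everything but `e^{K} ≤ E` is `norm_num`.
[cite: LiuStanley1972, p. 272 (interlayer mean-field T_c(ε))] [cite: AizenmanSimon1980RotorIsing, eq. (2)]
[cite: Wu1966, T > T_c asymptotics of D_n(φ_Onsager) (= DeiftItsKrasovsky2013 §5 eq. (64))] -/
theorem ofReal_le_layeredSusceptibilityCriticalCoupling_of_exp_le {Δ K E : ℝ} (hΔ : 0 ≤ Δ) (hK : 0 < K)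
    (hE : Real.exp K ≤ E) (hq1 : E * (E - 1) / (E + 1) < 1)
    (h : Δ * K * (1 + 8 * ((E * (E - 1) / (E + 1)) / (1 - E * (E - 1) / (E + 1)) ^ 2)) < 1) :
    ENNReal.ofReal K ≤ layeredSusceptibilityCriticalCoupling Δ := by
  have hq : (onsagerGammaTwo (K / 2))⁻¹ ≤ E * (E - 1) / (E + 1) := inv_onsagerGammaTwo_half_le_of_exp_le hK.le hE
  have hK2 : 0 < K / 2 := by positivity
  have hKc : K / 2 < criticalBetaTwo := (inv_onsagerGammaTwo_lt_one_iff hK2).1 (hq.trans_lt hq1)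
  have hmono := onsagerLength_closedForm_mono (inv_onsagerGammaTwo_pos hK2).le hq hq1
  refine ofReal_le_layeredSusceptibilityCriticalCoupling_of_onsagerLength hΔ hK hKc (lt_of_le_of_lt ?_ h)
  exact mul_le_mul_of_nonneg_left hmono (mul_nonneg hΔ hK.le)

/-- **Across-layer decay, rational-enclosure form** (the K5 trigger's body): `β, J∥ > 0`, `J⊥ ≥ 0`, `e^{βJ∥} ≤ E`,
`q̄ = E(E−1)/(E+1) < 1`, `βJ⊥(1 + 8q̄/(1−q̄)²) ≤ r` ⇒ `⟨cos(θ_a − θ_c)⟩_{Λ;β,J∥,J⊥} ≤ r^{|ℓ(a) − ℓ(c)|}` for every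
finite `Λ ⊂ ℤ³` and `a, c ∈ Λ`. [cite: Lieb1980, eq. (23) and notes added in proof (2)] [cite: AizenmanSimon1980RotorIsing, eq. (1)] -/
theorem twoPoint_layered_le_pow_of_exp_le (hβ : 0 < β) (hp : 0 < Jp) (hz : 0 ≤ Jz) {E r : ℝ}
    (hE : Real.exp (β * Jp) ≤ E) (hq1 : E * (E - 1) / (E + 1) < 1)
    (hr : β * Jz * (1 + 8 * ((E * (E - 1) / (E + 1)) / (1 - E * (E - 1) / (E + 1)) ^ 2)) ≤ r)
    (Λ : Finset (Site 3)) (a c : Λ) :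
    twoPoint (layeredXYCoupling β Jp Jz Λ) a c ≤ r ^ (layer a - layer c).natAbs := by
  have hq : (onsagerGammaTwo (β * Jp / 2))⁻¹ ≤ E * (E - 1) / (E + 1) :=
    inv_onsagerGammaTwo_half_le_of_exp_le (by positivity) hE
  exact twoPoint_layered_le_pow_of_inv_onsagerGammaTwo_le hβ hp hz hq hq1 hr Λ a c

end Enclosure

end PlaneRotator

end Literature.Probability.LatticeModels

end
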